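import Literature.Geometry.Kaehler.ComplexTorusIsogenyDegree
import Literature.NumberTheory.QuadraticFields.HeegnerCondition
import Mathlib.NumberTheory.NumberField.InfinitePlace.Embeddings
import HarnessLib

/-!
# Polarizations of a complex torus with `𝓞_K`-stable lattice are the integral positive-definite
# hermitian `𝓞_K`-lattices `(Γ^{α_R}, h^{α_R})` (Narbonne 2022, §2.3: Lemma 1, Prop. 1 (first
# sentence) and Theorem 2 on objects; `NS(X)` and `Γ̂` in hermitian terms)

Layer `Literature/Geometry/Kaehler`, namespace `Literature.Geometry.Kaehler.ComplexTorus`; lane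
`lit-hodgefound` (Track 2 foundations library), family `hodge`; FILE 1 of the row «polarized products of
CM elliptic curves» (sequel of `ComplexTorusProductOfCMEllipticCurves` / `ComplexTorusSteinitzClass(ification)`:
a complex torus whose period lattice is stable under `φ(𝓞_K)`, `K` imaginary quadratic, IS a product of CM
elliptic curves `E_{𝔞₁} × ⋯ × E_{𝔞ₙ}`).  THEOREMS ONLY: no definition, no named fact (net debt `0`).

## Source, VERBATIM

F. Narbonne, *Polarized products of elliptic curves with complex multiplication and field of moduli `ℚ`*,
Polynesian J. Math. **1** (2022) = arXiv:2203.11982 [Narbonne2022PolarizedProductsCM], held text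
`paper:arxiv-2203.11982`, chunks p0005–p0007:

* §1.1 "A torus `X = V/Γ`, or a lattice `Γ ⊆ V`, is said to be polarizable if there exists a positive
  definite hermitian form `h : V × V → ℂ` such that `Im h(Γ, Γ) ⊆ ℤ`."  §1.3 "A polarized torus is a
  couple `(V/Γ, ρ_h)` (also denoted by `(Γ, h)`) with `V/Γ` a complex torus and `ρ_h ∈ Hom_ℂ(Γ, Γ̂)`
  induced by a positive definite hermitian form `h`, i.e., `ρ_h(v) = h(v, _)`."
* §2.1 "Let `R = ℤ[ω]` be a maximal order of an imaginary quadratic field `K = ℚ(√Δ)` […] We chose `ω`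
  a generator of `R` with `α_R = Im ω > 0`. Notice that `α_R` does not depend on the chosen generator
  `ω` with positive imaginary part."
* §2.3 "A hermitian `R`-lattice is defined as couple `(L, H)` with `L` a `R`-lattice and `H` a positive
  definite hermitian form on the ambient space `KL`. […] A hermitian `R`-lattice `(L, H)` is said to be
  integral if `H(L, L) ⊆ R` […] We denote by `V^α` the vector space `V` provided with the hermitian form
  `H^α(x, y) = αH(x, y)`.
  **Lemma 1.** Let `𝔞` be a sub `R = ℤ[ω]`-module of `ℂ`. Then `𝔞` is an integral ideal of `R` if, and
  only if, `Im 𝔞 ⊆ α_R ℤ`, with `α_R = Im ω`.  *Proof.* The direct sense is straightforward. Let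
  `a = x + yω ∈ 𝔞` with `x, y ∈ ℝ`. Since, `Im a = y Im(ω) ∈ (Im ω)ℤ` we have `y ∈ ℤ`. Moreover, `ω̄ ∈ R`
  so `aω̄ ∈ 𝔞` and `Im aω̄ = −x Im ω` so `x ∈ ℤ`. Hence, `a ∈ ℤ[ω] = R` and then `𝔞 ⊆ R`.
  **Proposition 1.** Let `(V/Γ, ρ_h)` be a polarized torus such that `Γ ≃ ⊕ᵢ Λᵢ` with `End_ℂ(Λᵢ) ≃ R`
  with `R = ℤ[ω]`. Then `𝔰(Γ^{α_R})` is an integral ideal of `R`. […] *Proof.* We know that `h(Γ, Γ)` is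
  a sub `R`-module of `ℂ` and since `(Γ, h)` is a polarizable torus we must have `Im h(Γ, Γ) ⊆ ℤ`.
  Hence, by Lemma 1, `𝔰(Γ^{α_R}) = α_R h(Γ, Γ) ⊆ R`.
  **Theorem 2.** With the notations above there is an equivalence of categories given on objects by
  `PT_R → Rh-Lat`, `(X = V/Γ, ρ_h) ↦ (Γ^{α_R}, h^{α_R})`, `((L ⊗ ℂ)/L, H^{1/α_R}) ↤ (L, H)`."

## What is formalised (theorems only), and on which carriers

Tree vocabulary: a complex torus `X = E/Λ`, `Λ = Ψ(ℤ^ι)` for a period isomorphism `Ψ : ℝ^ι ≃ E`;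
a polarization of `X` is a Riemann form `ComplexTorus.IsRiemannForm Ψ ω` (`ω = E = Im h` of type
`(1,1)`, integral on `Λ`, `ω(iu, u) > 0`), and `h = hermOf ω` is its positive-definite hermitian form
(Lange 2023, Lemma 1.2.10: `H(v, w) = E(iv, w) + iE(v, w)`, `ℂ`-linear in `v`; `ComplexTorusCanonicalFactor`).
`K` is a number field with an integral basis `b = (1, ω)` of `𝓞_K` (`b : Basis (Fin 2) ℤ (𝓞 K)`,
`b 0 = 1`; exists iff `[K : ℚ] = 2`, `QuadraticFields/HeegnerCondition`), `φ : K →+* ℂ` with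
`α := Im φ(ω) ≠ 0` (i.e. `φ` is not real, `K` imaginary quadratic; `α > 0` after replacing `ω` by `−ω`),
`R := φ(𝓞_K) = ℤ + ℤφ(ω) ⊂ ℂ` (the subring `(φ.comp (algebraMap (𝓞 K) K)).range`); "`Γ` is an
`R`-module" is the hypothesis `hΛ : ∀ a m, ∃ m', φ(a) • latticeVec Ψ m = latticeVec Ψ m'` of
`ComplexTorusProductOfCMEllipticCurves` (under which `X ≅ ℂⁿ/∏φ(𝔞ᵢ) ≅ ∏ E_{𝔞ᵢ}`, loc. cit.).

* §1 **`exists_basis_zero_eq_one_im_pos`** (`R = ℤ[ω]` with `Im φ(ω) > 0` for `[K : ℚ] = 2`, `φ` not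
  real), `mem_range_iff_exists_int` (`R = ℤ + ℤφ(ω)`), `conj_apply_basis_one` (`ω̄ = t − ω ∈ R`),
  `exists_int_im_eq_of_mem_range` (`Im R = αℤ`), **`im_basis_one_eq_of_pos`** ("`α_R` does not depend
  on the chosen generator"), and **LEMMA 1 `subset_range_iff_forall_im`**: for a subset `S ⊆ ℂ` stable
  under multiplication by `R`, `S ⊆ R ⟺ Im S ⊆ αℤ` (the printed proof, verbatim).
* §2 **PROPOSITION 1, first sentence / THEOREM 2 (`→`) `IsRiemannForm.mul_hermOf_latticeVec_mem`** (and
  `IsNSForm.mul_hermOf_latticeVec_mem` for every `h ∈ NS(X)`): for a polarization `ω` of a torus with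
  `R`-stable lattice, `α · h(Γ, Γ) ⊆ R` — the hermitian lattice `(Γ^{α_R}, h^{α_R})` is INTEGRAL; with
  `hermOf_swap` (hermitian) and `IsRiemannForm.hermOf_self_pos` (positive definite) it is an integral
  positive-definite hermitian `R`-lattice.  `isNSForm_iff_hermOf` (Lange's "`NS(X)` as hermitian forms
  with `Im H(Λ, Λ) ⊆ ℤ`", read through Lemma 1) and **THEOREM 2, on objects, as one equivalence
  `isRiemannForm_iff_hermOf`**: a real `2`-form `ω` on `E` is a polarization of `X` IFF `h = hermOf ω`
  is hermitian, positive definite and `α·h(Γ, Γ) ⊆ R`.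
* §3 **THEOREM 2 (`←`), the inverse functor `(L, H) ↦ ((L ⊗ ℂ)/L, H^{1/α_R})`,
  `exists_isRiemannForm_mul_hermOf_eq`** (and `exists_isNSForm_mul_hermOf_eq` without positivity):
  every map `H : E → E → ℂ` which is `ℂ`-linear in the first slot, hermitian (`H(v, u) = conj H(u, v)`),
  positive definite (`Re H(u, u) > 0`, `u ≠ 0`) and integral on the lattice (`H(Γ, Γ) ⊆ R`) is
  `α · hermOf ω` for a Riemann form `ω` of `X` (for `α > 0`), UNIQUE by `eq_of_hermOf_eq`;
  `existsUnique_isRiemannForm_mul_hermOf_eq`.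
* §4 **`exists_dualPeriod_intVec_eq_iff_forall_mem_range`**: the dual lattice
  "`Γ̂ = {ℓ ∈ V^*, Im ℓ(Γ) ⊆ ℤ} = {ℓ ∈ V^*, α_R ℓ(Γ) ⊆ R}`" (§1.2, §3.3.1).

Sequel files of the row: `ComplexTorusPolarizedProductOfCMEllipticCurvesDegree` (coordinates on an
ideal-product presentation `Γ ≅ ∏φ(𝔞ᵢ)` — the Gram matrix over `K`; Prop. 1 second sentence
`deg ρ_h = ((Γ^{α_R})^♯ : Γ^{α_R})`; Remark 1, principal ⟺ unimodular; Thm. 1 proof, `R`-lattices are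
polarizable) and `ComplexTorusPolarizedProductOfCMEllipticCurvesMorphisms` (Theorems 1–2 on morphisms).

## References
* [Narbonne2022PolarizedProductsCM] F. Narbonne, arXiv:2203.11982 (2022), §1.1, §1.3, §2.1, §2.3
  Lemma 1, Prop. 1, Thm. 2.
* [Lange2023AbelianVarietiesComplex] H. Lange, *Abelian Varieties over the Complex Numbers* (2023),
  §1.2.2 Lemma 1.2.10 (`H ↔ E = Im H`), §2.1.1 (polarizations).
* [Marcus2018] D. A. Marcus, *Number Fields*, Ch. 2 (integral basis `(1, ω)` of a quadratic field).
-/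

noncomputable section

open Module Complex NumberField
open scoped ComplexConjugate

namespace Literature.Geometry.Kaehler

namespace ComplexTorus

/-! ## §1. `R = ℤ[ω] ⊂ ℂ`, the scale `α_R = Im ω`, and Lemma 1 -/

section Scale

variable {K : Type} [Field K] [NumberField K] (φ : K →+* ℂ)

omit [NumberField K] in
/-- Coordinates on an integral basis `(1, ω)`: every `r ∈ 𝓞_K` is `p + qω` with `p, q ∈ ℤ`. [folklore] -/
private theorem eq_repr_add_repr_mul_basis_one (b : Basis (Fin 2) ℤ (𝓞 K)) (hb : b 0 = 1)
    (r : 𝓞 K) :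
    r = (b.repr r 0 : 𝓞 K) + (b.repr r 1 : 𝓞 K) * b 1 := by
  conv_lhs => rw [← b.sum_repr r]
  rw [Fin.sum_univ_two, hb, zsmul_eq_mul, mul_one, zsmul_eq_mul]

omit [NumberField K] in
/-- **`R = φ(𝓞_K) = ℤ + ℤφ(ω)`**: membership in the image of the ring of integers under the embedding.
[cite: Narbonne2022PolarizedProductsCM, §2.1 (`R = ℤ[ω]`)] -/
theorem mem_range_iff_exists_int (b : Basis (Fin 2) ℤ (𝓞 K)) (hb : b 0 = 1) (z : ℂ) :
    z ∈ (φ.comp (algebraMap (𝓞 K) K)).range ↔ ∃ p q : ℤ, z = p + q * φ (b 1 : K) := by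
  constructor
  · rintro ⟨r, rfl⟩
    refine ⟨b.repr r 0, b.repr r 1, ?_⟩
    conv_lhs => rw [eq_repr_add_repr_mul_basis_one b hb r]
    simp [map_intCast]
  · rintro ⟨p, q, rfl⟩
    refine ⟨(p : 𝓞 K) + (q : 𝓞 K) * b 1, ?_⟩
    simp [map_intCast]

omit [NumberField K] in
/-- `φ(r) ∈ R` for `r ∈ 𝓞_K`. [folklore] -/
private theorem apply_mem_range (r : 𝓞 K) :
    φ (r : K) ∈ (φ.comp (algebraMap (𝓞 K) K)).range := ⟨r, rfl⟩

omit [NumberField K] in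
/-- `φ(ω)² = m + tφ(ω)` for the coordinates `(m, t)` of `ω²` on `(1, ω)`. [folklore] -/
private theorem apply_basis_one_mul_self (b : Basis (Fin 2) ℤ (𝓞 K)) (hb : b 0 = 1) :
    φ (b 1 : K) * φ (b 1 : K) =
      (b.repr (b 1 * b 1) 0 : ℂ) + (b.repr (b 1 * b 1) 1 : ℂ) * φ (b 1 : K) := by
  have h := congrArg (fun x : 𝓞 K ↦ φ (x : K))
    (Literature.NumberTheory.QuadraticFields.Quadratic.basis_one_mul_self_eq b hb)
  simpa [map_intCast] using h

omit [NumberField K] in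
/-- **`ω̄ = t − ω`**: the complex conjugate of `φ(ω)` is the other root of `X² − tX − m`, provided
`φ(ω) ∉ ℝ` ("`ω̄ ∈ R`"). [cite: Narbonne2022PolarizedProductsCM, §2.3 Lemma 1 (proof)] -/
theorem conj_apply_basis_one (b : Basis (Fin 2) ℤ (𝓞 K)) (hb : b 0 = 1)
    (hφ : (φ (b 1 : K)).im ≠ 0) :
    conj (φ (b 1 : K)) = (b.repr (b 1 * b 1) 1 : ℂ) - φ (b 1 : K) := by
  set w := φ (b 1 : K) with hw
  set m : ℤ := b.repr (b 1 * b 1) 0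
  set t : ℤ := b.repr (b 1 * b 1) 1
  have h1 : w * w = (m : ℂ) + (t : ℂ) * w := apply_basis_one_mul_self φ b hb
  have h2 : conj w * conj w = (m : ℂ) + (t : ℂ) * conj w := by
    have h := congrArg conj h1
    simpa [map_add, map_mul] using h
  have hne : w - conj w ≠ 0 := by
    intro h0
    rw [sub_eq_zero] at h0
    exact hφ (Complex.conj_eq_iff_im.mp h0.symm)
  have key : (w - conj w) * (w + conj w - t) = 0 := by linear_combination h1 - h2
  have h3 := (mul_eq_zero.mp key).resolve_left hne
  linear_combination h3

omit [NumberField K] in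
/-- `ω̄ ∈ R`: the conjugate `φ(ω)‾ = φ(t − ω)`. [cite: Narbonne2022PolarizedProductsCM, §2.3 Lemma 1 (proof, "`ω̄ ∈ R`")] -/
theorem conj_apply_basis_one_eq_apply (b : Basis (Fin 2) ℤ (𝓞 K)) (hb : b 0 = 1)
    (hφ : (φ (b 1 : K)).im ≠ 0) :
    conj (φ (b 1 : K)) = φ (((b.repr (b 1 * b 1) 1 : 𝓞 K) - b 1 : 𝓞 K) : K) := by
  rw [conj_apply_basis_one φ b hb hφ]
  simp [map_intCast]

omit [NumberField K] in
/-- **`R` is stable under complex conjugation**: `conj φ(r) ∈ R` for `r ∈ 𝓞_K`.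
[cite: Narbonne2022PolarizedProductsCM, §2.3 Lemma 1 (proof, "`ω̄ ∈ R`")] -/
theorem conj_mem_range (b : Basis (Fin 2) ℤ (𝓞 K)) (hb : b 0 = 1) (hφ : (φ (b 1 : K)).im ≠ 0)
    {z : ℂ} (hz : z ∈ (φ.comp (algebraMap (𝓞 K) K)).range) :
    conj z ∈ (φ.comp (algebraMap (𝓞 K) K)).range := by
  obtain ⟨p, q, rfl⟩ := (mem_range_iff_exists_int φ b hb z).mp hz
  rw [mem_range_iff_exists_int φ b hb]
  refine ⟨p + q * b.repr (b 1 * b 1) 1, -q, ?_⟩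
  rw [map_add, map_mul, conj_apply_basis_one φ b hb hφ]
  simp only [map_intCast]
  push_cast
  ring

omit [NumberField K] in
/-- **`Im R = α_R ℤ`** (the "direct sense" of Lemma 1): `Im φ(r) ∈ ℤ·Im φ(ω)` for `r ∈ 𝓞_K`.
[cite: Narbonne2022PolarizedProductsCM, §2.3 Lemma 1] -/
theorem exists_int_im_eq_of_mem_range (b : Basis (Fin 2) ℤ (𝓞 K)) (hb : b 0 = 1) {z : ℂ}
    (hz : z ∈ (φ.comp (algebraMap (𝓞 K) K)).range) :
    ∃ q : ℤ, z.im = q * (φ (b 1 : K)).im := by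
  obtain ⟨p, q, rfl⟩ := (mem_range_iff_exists_int φ b hb z).mp hz
  exact ⟨q, by simp⟩

omit [NumberField K] in
/-- **Narbonne 2022, Lemma 1: "Let `𝔞` be a sub `R = ℤ[ω]`-module of `ℂ`. Then `𝔞` is an integral
ideal of `R` if, and only if, `Im 𝔞 ⊆ α_R ℤ`, with `α_R = Im ω`."** — for any subset `S ⊆ ℂ` stable
under multiplication by `R = φ(𝓞_K)` (additivity is not used): `S ⊆ R ⟺ Im s ∈ ℤ·Im φ(ω)` for all
`s ∈ S`.  Printed proof: `a = x + yω`, `Im a = y Im ω ⇒ y ∈ ℤ`; `aω̄ ∈ 𝔞`, `Im aω̄ = −x Im ω ⇒ x ∈ ℤ`.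
[cite: Narbonne2022PolarizedProductsCM, §2.3 Lemma 1] -/
theorem subset_range_iff_forall_im (b : Basis (Fin 2) ℤ (𝓞 K)) (hb : b 0 = 1)
    (hφ : (φ (b 1 : K)).im ≠ 0) {S : Set ℂ} (hS : ∀ (r : 𝓞 K), ∀ s ∈ S, φ (r : K) * s ∈ S) :
    S ⊆ (φ.comp (algebraMap (𝓞 K) K)).range ↔
      ∀ s ∈ S, ∃ q : ℤ, s.im = q * (φ (b 1 : K)).im := by
  refine ⟨fun h s hs ↦ exists_int_im_eq_of_mem_range φ b hb (h hs), fun h s hs ↦ ?_⟩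
  set w := φ (b 1 : K) with hw
  obtain ⟨q, hq⟩ := h s hs
  -- `a = x + yω` with `y = q ∈ ℤ` and `x ∈ ℝ`
  set x : ℝ := s.re - q * w.re with hx
  have hsx : s = (x : ℂ) + (q : ℂ) * w := by
    apply Complex.ext
    · simp [hx]
    · simp [hq]
  -- `aω̄ ∈ 𝔞`
  have hs' : conj w * s ∈ S := by
    rw [hw, conj_apply_basis_one_eq_apply φ b hb hφ]
    exact hS _ s hs
  obtain ⟨q', hq'⟩ := h _ hs'
  -- `Im aω̄ = -x Im ω`
  have him : (conj w * s).im = -x * w.im := by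
    rw [hsx]
    simp only [mul_add, Complex.add_im, Complex.mul_im, Complex.conj_re, Complex.conj_im,
      Complex.ofReal_re, Complex.ofReal_im, Complex.mul_re, Complex.intCast_re, Complex.intCast_im]
    ring
  have hxq : x = -q' := by
    have h' : -x * w.im = q' * w.im := by rw [← him, hq']
    have := mul_right_cancel₀ hφ h'
    linarith
  rw [SetLike.mem_coe, mem_range_iff_exists_int φ b hb]
  exact ⟨-q', q, by rw [hsx, hxq]; push_cast; ring⟩

/-- If `Im φ(ω) = 0` the embedding `φ` is real (`K = Frac 𝓞_K` and `𝓞_K = ℤ + ℤω`). [folklore] -/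
private theorem isReal_of_im_basis_one_eq_zero (b : Basis (Fin 2) ℤ (𝓞 K)) (hb : b 0 = 1)
    (h0 : (φ (b 1 : K)).im = 0) : ComplexEmbedding.IsReal φ := by
  -- every `φ(r)`, `r ∈ 𝓞_K`, is real
  have hint : ∀ r : 𝓞 K, (φ (r : K)).im = 0 := fun r ↦ by
    obtain ⟨q, hq⟩ := exists_int_im_eq_of_mem_range φ b hb (apply_mem_range φ r)
    rw [hq, h0, mul_zero]
  have hreal : ∀ r : 𝓞 K, φ (r : K) = ((φ (r : K)).re : ℂ) := fun r ↦ by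
    apply Complex.ext <;> simp [hint r]
  rw [ComplexEmbedding.isReal_iff]
  ext k
  rw [ComplexEmbedding.conjugate_coe_eq, Complex.conj_eq_iff_im]
  obtain ⟨x, y, -, hxy⟩ := IsFractionRing.div_surjective (A := 𝓞 K) k
  rw [← hxy, map_div₀]
  change (φ (x : K) / φ (y : K)).im = 0
  rw [hreal x, hreal y, ← Complex.ofReal_div, Complex.ofReal_im]

/-- **`R = ℤ[ω]` with `α_R = Im ω > 0`**: for `[K : ℚ] = 2` and a non-real embedding `φ` there is an
integral basis `(1, ω)` of `𝓞_K` with `Im φ(ω) > 0` ("We chose `ω` a generator of `R` with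
`α_R = Im ω > 0`"; Marcus Ch. 2: `1` extends to a `ℤ`-basis of `𝓞_K`).
[cite: Narbonne2022PolarizedProductsCM, §2.1] -/
theorem exists_basis_zero_eq_one_im_pos (h2 : finrank ℚ K = 2) (hφ : ¬ ComplexEmbedding.IsReal φ) :
    ∃ b : Basis (Fin 2) ℤ (𝓞 K), b 0 = 1 ∧ 0 < (φ (b 1 : K)).im := by
  obtain ⟨b, hb⟩ := Literature.NumberTheory.QuadraticFields.Quadratic.exists_basis_zero_eq_one h2
  have hne : (φ (b 1 : K)).im ≠ 0 := fun h0 ↦ hφ (isReal_of_im_basis_one_eq_zero φ b hb h0)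
  rcases lt_or_gt_of_ne hne with hlt | hgt
  · refine ⟨b.unitsSMul ![1, -1], by simp [Basis.unitsSMul_apply, hb], ?_⟩
    have h1 : (b.unitsSMul ![1, -1]) 1 = -b 1 := by simp [Basis.unitsSMul_apply]
    rw [h1]
    push_cast
    rw [map_neg, Complex.neg_im]
    linarith
  · exact ⟨b, hb, hgt⟩

omit [NumberField K] in
/-- **"`α_R` does not depend on the chosen generator `ω` with positive imaginary part"**: two integral
bases `(1, ω)`, `(1, ω')` of `𝓞_K` with `Im φ(ω), Im φ(ω') > 0` have `Im φ(ω) = Im φ(ω')`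
(`ω' = p + qω`, `ω = p' + q'ω'` force `qq' = 1`, and positivity `q = 1`).
[cite: Narbonne2022PolarizedProductsCM, §2.1] -/
theorem im_basis_one_eq_of_pos (b b' : Basis (Fin 2) ℤ (𝓞 K)) (hb : b 0 = 1) (hb' : b' 0 = 1)
    (hpos : 0 < (φ (b 1 : K)).im) (hpos' : 0 < (φ (b' 1 : K)).im) :
    (φ (b 1 : K)).im = (φ (b' 1 : K)).im := by
  obtain ⟨q, hq⟩ := exists_int_im_eq_of_mem_range φ b hb (apply_mem_range φ (b' 1))
  obtain ⟨q', hq'⟩ := exists_int_im_eq_of_mem_range φ b' hb' (apply_mem_range φ (b 1))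
  have hqq : (q : ℝ) * q' = 1 := by
    have h : (φ (b 1 : K)).im = q' * (q * (φ (b 1 : K)).im) := by rw [← hq, ← hq']
    have h' : ((q : ℝ) * q' - 1) * (φ (b 1 : K)).im = 0 := by linear_combination -h
    have := (mul_eq_zero.mp h').resolve_right hpos.ne'
    linarith
  have hq_pos : (0 : ℝ) < q := by
    by_contra hle
    replace hle : (q : ℝ) ≤ 0 := not_lt.mp hle
    have : (φ (b' 1 : K)).im ≤ 0 := by
      rw [hq]; exact mul_nonpos_of_nonpos_of_nonneg hle hpos.le
    linarith
  have hqq' : q * q' = 1 := by exact_mod_cast hqq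
  have hq1 : q = 1 := by
    rcases Int.eq_one_or_neg_one_of_mul_eq_one hqq' with h | h
    · exact h
    · exfalso; rw [h] at hq_pos; norm_num at hq_pos
  rw [hq, hq1, Int.cast_one, one_mul]

end Scale

/-! ## §2. Theorem 2 (`→`) and Proposition 1, first sentence: `α_R · h(Γ, Γ) ⊆ R` for a polarization -/

section Torus

variable {K : Type} [Field K] (φ : K →+* ℂ)
variable {ι : Type*} {E : Type*} [NormedAddCommGroup E] [NormedSpace ℂ E]

/-- **The hermitian form of a polarization is positive definite**: `Re h(u, u) = E(iu, u) > 0` for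
`u ≠ 0`. [cite: Narbonne2022PolarizedProductsCM, §1.3 ("a positive definite hermitian form `h`")] -/
theorem IsRiemannForm.hermOf_self_pos {Ψ : (ι → ℝ) ≃L[ℝ] E} {ω : E [⋀^Fin 2]→L[ℝ] ℝ}
    (hω : IsRiemannForm Ψ ω) {u : E} (hu : u ≠ 0) : 0 < (hermOf ω u u).re := by
  rw [hermOf_re]
  exact hω.2.2 u hu

/-- **A `2`-form is determined by its hermitian form** (`E = Im H`): `hermOf ω = hermOf ω' ⇒ ω = ω'`.
[cite: Lange2023AbelianVarietiesComplex, §1.2.2 Lemma 1.2.10] -/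
theorem eq_of_hermOf_eq {ω ω' : E [⋀^Fin 2]→L[ℝ] ℝ} (h : ∀ u v : E, hermOf ω u v = hermOf ω' u v) :
    ω = ω' := by
  ext v
  have hv : v = ![v 0, v 1] := by
    funext i
    fin_cases i <;> rfl
  rw [hv, ← hermOf_im ω, ← hermOf_im ω', h]

/-- **`α_R · h(Γ, Γ) ⊆ R` for every `h ∈ NS(X)`** (Lemma 1 applied to the sub-`R`-module `h(Γ, Γ)` of
`ℂ`, for a `(1,1)`-form `ω = Im h` integral on the `R`-stable lattice `Γ`; positivity is not used).
Lange: "Consider the Néron–Severi group `NS(X)` as the group of hermitian forms `H` with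
`Im H(Λ, Λ) ⊆ ℤ`". [cite: Narbonne2022PolarizedProductsCM, §2.3 Prop. 1 (proof) and Lemma 1]
[cite: Lange2023AbelianVarietiesComplex, §1.3.1] -/
theorem IsNSForm.mul_hermOf_latticeVec_mem (b : Basis (Fin 2) ℤ (𝓞 K)) (hb : b 0 = 1)
    (hφ : (φ (b 1 : K)).im ≠ 0) {Ψ : (ι → ℝ) ≃L[ℝ] E} {ω : E [⋀^Fin 2]→L[ℝ] ℝ}
    (hω : IsNSForm Ψ ω)
    (hΛ : ∀ (a : 𝓞 K) (m : ι → ℤ), ∃ m' : ι → ℤ, (φ (a : K)) • latticeVec Ψ m = latticeVec Ψ m')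
    (m m' : ι → ℤ) :
    ((φ (b 1 : K)).im : ℂ) * hermOf ω (latticeVec Ψ m) (latticeVec Ψ m') ∈
      (φ.comp (algebraMap (𝓞 K) K)).range := by
  set S : Set ℂ := {z | ∃ m m' : ι → ℤ,
    z = ((φ (b 1 : K)).im : ℂ) * hermOf ω (latticeVec Ψ m) (latticeVec Ψ m')} with hSdef
  -- `h(Γ, Γ)` is a sub-`R`-module of `ℂ`
  have hS : ∀ (r : 𝓞 K), ∀ s ∈ S, φ (r : K) * s ∈ S := by
    rintro r s ⟨n, n', rfl⟩
    obtain ⟨n'', hn''⟩ := hΛ r n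
    refine ⟨n'', n', ?_⟩
    rw [← hn'', hermOf_smul_left]
    ring
  -- `Im h(Γ, Γ) ⊆ ℤ`
  have him : ∀ s ∈ S, ∃ q : ℤ, s.im = q * (φ (b 1 : K)).im := by
    rintro s ⟨n, n', rfl⟩
    obtain ⟨k, hk⟩ := hω.integral n n'
    refine ⟨k, ?_⟩
    rw [Complex.im_ofReal_mul, hermOf_im, hk, mul_comm]
  exact (subset_range_iff_forall_im φ b hb hφ hS).mpr him ⟨m, m', rfl⟩

/-- **Narbonne 2022, Proposition 1 (first sentence) / Theorem 2 on objects, `(X, ρ_h) ↦ (Γ^{α_R}, h^{α_R})`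
is INTEGRAL: "`𝔰(Γ^{α_R}) = α_R h(Γ, Γ) ⊆ R`".**  For a polarization `ω` (`h = hermOf ω`) of a complex
torus `X = E/Ψ(ℤ^ι)` whose lattice `Γ` is stable under `R = φ(𝓞_K)`, `R = ℤ[ω₀]`, `α = Im φ(ω₀) ≠ 0`:
`α · h(γ, γ') ∈ R` for all `γ, γ' ∈ Γ`.  Printed proof: `h(Γ, Γ)` is a sub-`R`-module of `ℂ` (`h` is
`ℂ`-linear in the first slot and `RΓ = Γ`) with `Im h(Γ, Γ) ⊆ ℤ`; Lemma 1.
[cite: Narbonne2022PolarizedProductsCM, §2.3 Prop. 1 and Thm. 2] -/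
theorem IsRiemannForm.mul_hermOf_latticeVec_mem (b : Basis (Fin 2) ℤ (𝓞 K)) (hb : b 0 = 1)
    (hφ : (φ (b 1 : K)).im ≠ 0) {Ψ : (ι → ℝ) ≃L[ℝ] E} {ω : E [⋀^Fin 2]→L[ℝ] ℝ}
    (hω : IsRiemannForm Ψ ω)
    (hΛ : ∀ (a : 𝓞 K) (m : ι → ℤ), ∃ m' : ι → ℤ, (φ (a : K)) • latticeVec Ψ m = latticeVec Ψ m')
    (m m' : ι → ℤ) :
    ((φ (b 1 : K)).im : ℂ) * hermOf ω (latticeVec Ψ m) (latticeVec Ψ m') ∈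
      (φ.comp (algebraMap (𝓞 K) K)).range :=
  hω.isNSForm.mul_hermOf_latticeVec_mem φ b hb hφ hΛ m m'

/-- **`NS(X)` in hermitian terms**: a real `2`-form `ω` is in `NS(X)` (type `(1,1)` and integral on the
`R`-stable lattice `Γ`) iff `h = hermOf ω` is hermitian and `α · h(Γ, Γ) ⊆ R` — Lange's "`NS(X)` as the
group of hermitian forms `H` with `Im H(Λ, Λ) ⊆ ℤ`" read through Lemma 1 (`Im R = αℤ`).
[cite: Lange2023AbelianVarietiesComplex, §1.3.1] [cite: Narbonne2022PolarizedProductsCM, §2.3 Lemma 1] -/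
theorem isNSForm_iff_hermOf (b : Basis (Fin 2) ℤ (𝓞 K)) (hb : b 0 = 1)
    (hφ : (φ (b 1 : K)).im ≠ 0) (Ψ : (ι → ℝ) ≃L[ℝ] E)
    (hΛ : ∀ (a : 𝓞 K) (m : ι → ℤ), ∃ m' : ι → ℤ, (φ (a : K)) • latticeVec Ψ m = latticeVec Ψ m')
    (ω : E [⋀^Fin 2]→L[ℝ] ℝ) :
    IsNSForm Ψ ω ↔
      (∀ u v : E, hermOf ω v u = conj (hermOf ω u v)) ∧
      ∀ m m' : ι → ℤ, ((φ (b 1 : K)).im : ℂ) * hermOf ω (latticeVec Ψ m) (latticeVec Ψ m') ∈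
        (φ.comp (algebraMap (𝓞 K) K)).range := by
  constructor
  · intro hω
    exact ⟨fun u v ↦ hermOf_swap ω hω.type_one_one u v,
      fun m m' ↦ hω.mul_hermOf_latticeVec_mem φ b hb hφ hΛ m m'⟩
  · rintro ⟨hswap, hint⟩
    -- `Re h` symmetric: `ω(iv, u) = ω(iu, v)`
    have hre : ∀ u v : E, ω ![I • v, u] = ω ![I • u, v] := fun u v ↦ by
      have h := congrArg Complex.re (hswap u v)
      rwa [hermOf_re, Complex.conj_re, hermOf_re] at h
    refine ⟨fun u v ↦ ?_, fun m n ↦ ?_⟩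
    · -- type `(1,1)`: `ω(i·iv, u) = ω(iu, iv)`, i.e. `ω(iu, iv) = -ω(v, u) = ω(u, v)`
      have h := hre (I • v) u
      rw [smul_smul, Complex.I_mul_I, neg_one_smul, ← neg_one_smul ℝ v, twoForm_smul_left,
        twoForm_swap ω v u] at h
      rw [h]
      ring
    · -- integral on the lattice
      obtain ⟨q, hq⟩ := exists_int_im_eq_of_mem_range φ b hb (hint m n)
      rw [Complex.im_ofReal_mul, hermOf_im] at hq
      exact ⟨q, mul_left_cancel₀ hφ (hq.trans (mul_comm _ _))⟩

/-- **Narbonne 2022, Theorem 2 on objects, as ONE equivalence: a real `2`-form `ω` is a polarization of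
the torus `X = V/Γ` with `R`-stable lattice iff `(Γ^{α_R}, h^{α_R})` is an integral positive-definite
hermitian `R`-lattice** — i.e. iff `h = hermOf ω` is hermitian (`h(v, u) = conj h(u, v)`), positive
definite (`Re h(u, u) > 0` for `u ≠ 0`) and `α · h(Γ, Γ) ⊆ R` ("`(X = V/Γ, ρ_h) ↦ (Γ^{α_R}, h^{α_R})`"
lands in `Rh-Lat` and is essentially injective on objects; `α = Im φ(ω₀) ≠ 0`).
[cite: Narbonne2022PolarizedProductsCM, §2.3 Thm. 2 (with §1.1, §1.3 and Lemma 1)] -/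
theorem isRiemannForm_iff_hermOf (b : Basis (Fin 2) ℤ (𝓞 K)) (hb : b 0 = 1)
    (hφ : (φ (b 1 : K)).im ≠ 0) (Ψ : (ι → ℝ) ≃L[ℝ] E)
    (hΛ : ∀ (a : 𝓞 K) (m : ι → ℤ), ∃ m' : ι → ℤ, (φ (a : K)) • latticeVec Ψ m = latticeVec Ψ m')
    (ω : E [⋀^Fin 2]→L[ℝ] ℝ) :
    IsRiemannForm Ψ ω ↔
      (∀ u v : E, hermOf ω v u = conj (hermOf ω u v)) ∧
      (∀ u : E, u ≠ 0 → 0 < (hermOf ω u u).re) ∧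
      ∀ m m' : ι → ℤ, ((φ (b 1 : K)).im : ℂ) * hermOf ω (latticeVec Ψ m) (latticeVec Ψ m') ∈
        (φ.comp (algebraMap (𝓞 K) K)).range := by
  rw [show IsRiemannForm Ψ ω ↔ IsNSForm Ψ ω ∧ ∀ u : E, u ≠ 0 → 0 < ω ![I • u, u] from
    ⟨fun h ↦ ⟨h.isNSForm, h.2.2⟩, fun h ↦ ⟨h.1.type_one_one, h.1.integral, h.2⟩⟩,
    isNSForm_iff_hermOf φ b hb hφ Ψ hΛ ω]
  simp only [hermOf_re]
  tauto

/-! ## §3. Theorem 2 (`←`): `(L, H) ↦ ((L ⊗ ℂ)/L, H^{1/α_R})` is a polarized torus -/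

variable [Fintype ι]

/-- **The `2`-form `ω = Im(α⁻¹H) ∈ NS(X)` of an integral hermitian form** (no positivity): every
`H : E × E → ℂ`, `ℂ`-linear in the first slot, hermitian and integral on the lattice (`H(Γ, Γ) ⊆ R`),
is `α · hermOf ω` for an `ω ∈ NS(X)` (type `(1,1)`, integral on `Γ`) — Lange's "`NS(X)` as the group of
hermitian forms with `Im H(Λ, Λ) ⊆ ℤ`" and `Im R = αℤ` (Lemma 1, direct sense).
[cite: Lange2023AbelianVarietiesComplex, §1.3.1 and §1.2.2 Lemma 1.2.10]
[cite: Narbonne2022PolarizedProductsCM, §2.3 Lemma 1 and Thm. 2] -/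
theorem exists_isNSForm_mul_hermOf_eq (b : Basis (Fin 2) ℤ (𝓞 K)) (hb : b 0 = 1)
    (hφ : (φ (b 1 : K)).im ≠ 0) (Ψ : (ι → ℝ) ≃L[ℝ] E) (H : E → E → ℂ)
    (hadd : ∀ u u' v : E, H (u + u') v = H u v + H u' v)
    (hsmul : ∀ (c : ℂ) (u v : E), H (c • u) v = c * H u v)
    (hswap : ∀ u v : E, H v u = conj (H u v))
    (hint : ∀ m m' : ι → ℤ, H (latticeVec Ψ m) (latticeVec Ψ m') ∈
      (φ.comp (algebraMap (𝓞 K) K)).range) :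
    ∃ ω : E [⋀^Fin 2]→L[ℝ] ℝ, IsNSForm Ψ ω ∧
      ∀ u v : E, ((φ (b 1 : K)).im : ℂ) * hermOf ω u v = H u v := by
  classical
  set α : ℝ := (φ (b 1 : K)).im with hαdef
  -- sesquilinearity in the second slot, from hermitian symmetry
  have hadd' : ∀ u v v' : E, H u (v + v') = H u v + H u v' := fun u v v' ↦ by
    rw [hswap (v + v') u, hadd, map_add, ← hswap v u, ← hswap v' u]
  have hsmul' : ∀ (c : ℂ) (u v : E), H u (c • v) = conj c * H u v := fun c u v ↦ by
    rw [hswap (c • v) u, hsmul, map_mul, ← hswap v u]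
  have hself : ∀ u : E, (H u u).im = 0 := fun u ↦
    Complex.conj_eq_iff_im.mp (hswap u u).symm
  have hrsmul : ∀ (r : ℝ) (u v : E), H (r • u) v = (r : ℂ) * H u v := fun r u v ↦ by
    rw [← Complex.coe_smul, hsmul]
  have hrsmul' : ∀ (r : ℝ) (u v : E), H u (r • v) = (r : ℂ) * H u v := fun r u v ↦ by
    rw [← Complex.coe_smul, hsmul', Complex.conj_ofReal]
  -- the real alternating form `B(x, y) = α⁻¹ Im H(Ψx, Ψy)` on the lattice space
  let B : LinearMap.BilinForm ℝ (ι → ℝ) := LinearMap.mk₂ ℝ (fun x y ↦ α⁻¹ * (H (Ψ x) (Ψ y)).im)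
    (fun x x' y ↦ by simp only [map_add, hadd, Complex.add_im]; ring)
    (fun r x y ↦ by simp only [map_smul, hrsmul, Complex.im_ofReal_mul, smul_eq_mul]; ring)
    (fun x y y' ↦ by simp only [map_add, hadd', Complex.add_im]; ring)
    (fun r x y ↦ by simp only [map_smul, hrsmul', Complex.im_ofReal_mul, smul_eq_mul]; ring)
  have hBxy : ∀ x y, B x y = α⁻¹ * (H (Ψ x) (Ψ y)).im := fun x y ↦ rfl
  have hB : ∀ x, B x x = 0 := fun x ↦ by rw [hBxy, hself, mul_zero]
  have happly : ∀ u v : E, twoForm Ψ B hB ![u, v] = α⁻¹ * (H u v).im := fun u v ↦ by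
    rw [twoForm_apply]
    simp only [Matrix.cons_val_zero, Matrix.cons_val_one]
    rw [hBxy, ContinuousLinearEquiv.apply_symm_apply, ContinuousLinearEquiv.apply_symm_apply]
  have hII : ∀ z : ℂ, I * (conj I * z) = z := fun z ↦ by
    rw [Complex.conj_I, ← mul_assoc, mul_neg, Complex.I_mul_I, neg_neg, one_mul]
  refine ⟨twoForm Ψ B hB, ⟨fun u v ↦ ?_, fun m n ↦ ?_⟩, fun u v ↦ ?_⟩
  · -- type `(1,1)`: `H(iu, iv) = H(u, v)`
    rw [happly, happly, hsmul, hsmul', hII]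
  · -- integral: `H(Γ, Γ) ⊆ R ⇒ Im H(Γ, Γ) ⊆ αℤ`
    obtain ⟨q, hq⟩ := exists_int_im_eq_of_mem_range φ b hb (hint m n)
    refine ⟨q, ?_⟩
    rw [happly, hq, ← hαdef, mul_comm, mul_assoc, mul_inv_cancel₀ hφ, mul_one]
  · -- `α · hermOf ω = H`
    rw [hermOf_apply, happly, happly, hsmul, Complex.I_mul_im]
    apply Complex.ext
    · simp only [Complex.mul_re, Complex.add_re, Complex.add_im, Complex.ofReal_re,
        Complex.ofReal_im, Complex.mul_im, Complex.I_re, Complex.I_im]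
      field_simp
      ring
    · simp only [Complex.mul_re, Complex.add_re, Complex.add_im, Complex.ofReal_re,
        Complex.ofReal_im, Complex.mul_im, Complex.I_re, Complex.I_im]
      field_simp
      ring

/-- **Narbonne 2022, Theorem 2 on objects, the inverse functor `(L, H) ↦ ((L ⊗ ℂ)/L, H^{1/α_R})`:
every integral positive-definite hermitian form is `h^{α_R}` for a unique polarization.**  Let
`X = E/Ψ(ℤ^ι)` be a complex torus, `R = φ(𝓞_K) = ℤ[ω₀]` with `α = Im φ(ω₀) > 0`, and let
`H : E × E → ℂ` be `ℂ`-linear in the first slot, hermitian (`H(v, u) = conj H(u, v)`), positive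
definite (`Re H(u, u) > 0` for `u ≠ 0`) and integral on the lattice (`H(Γ, Γ) ⊆ R`). Then
`H^{1/α} = α⁻¹ H` is the hermitian form `hermOf ω` of a Riemann form `ω = Im(α⁻¹H)` of `X`:
type `(1,1)` because `H(iu, iv) = i·ī·H(u, v)`, integral because `Im R = αℤ` (Lemma 1, direct sense),
positive because `Im(α⁻¹H(iu, u)) = α⁻¹ Re H(u, u) > 0`.
[cite: Narbonne2022PolarizedProductsCM, §2.3 Thm. 2 (with §1.1 and Lemma 1)] -/
theorem exists_isRiemannForm_mul_hermOf_eq (b : Basis (Fin 2) ℤ (𝓞 K)) (hb : b 0 = 1)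
    (hα : 0 < (φ (b 1 : K)).im) (Ψ : (ι → ℝ) ≃L[ℝ] E) (H : E → E → ℂ)
    (hadd : ∀ u u' v : E, H (u + u') v = H u v + H u' v)
    (hsmul : ∀ (c : ℂ) (u v : E), H (c • u) v = c * H u v)
    (hswap : ∀ u v : E, H v u = conj (H u v))
    (hpos : ∀ u : E, u ≠ 0 → 0 < (H u u).re)
    (hint : ∀ m m' : ι → ℤ, H (latticeVec Ψ m) (latticeVec Ψ m') ∈
      (φ.comp (algebraMap (𝓞 K) K)).range) :
    ∃ ω : E [⋀^Fin 2]→L[ℝ] ℝ, IsRiemannForm Ψ ω ∧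
      ∀ u v : E, ((φ (b 1 : K)).im : ℂ) * hermOf ω u v = H u v := by
  obtain ⟨ω, hω, hωH⟩ := exists_isNSForm_mul_hermOf_eq φ b hb hα.ne' Ψ H hadd hsmul hswap hint
  refine ⟨ω, ⟨hω.type_one_one, hω.integral, fun u hu ↦ ?_⟩, hωH⟩
  -- positive: `ω(iu, u) = Re h(u, u) = α⁻¹ Re H(u, u)`
  have h := congrArg Complex.re (hωH u u)
  rw [Complex.re_ofReal_mul, hermOf_re] at h
  have hpos' : 0 < (φ (b 1 : K)).im * ω ![I • u, u] := by rw [h]; exact hpos u hu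
  exact pos_of_mul_pos_right hpos' hα.le

/-- **Theorem 2 on objects, `(L, H) ↦ ((L ⊗ ℂ)/L, H^{1/α_R})` with uniqueness**: the polarization
`ω` with `α · hermOf ω = H` of `exists_isRiemannForm_mul_hermOf_eq` is unique (`E = Im h`), so that
`(X, ρ_h) ↦ (Γ^{α_R}, h^{α_R})` and `(L, H) ↦ ((L ⊗ ℂ)/L, H^{1/α_R})` are mutually inverse on objects.
[cite: Narbonne2022PolarizedProductsCM, §2.3 Thm. 2] -/
theorem existsUnique_isRiemannForm_mul_hermOf_eq (b : Basis (Fin 2) ℤ (𝓞 K)) (hb : b 0 = 1)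
    (hα : 0 < (φ (b 1 : K)).im) (Ψ : (ι → ℝ) ≃L[ℝ] E) (H : E → E → ℂ)
    (hadd : ∀ u u' v : E, H (u + u') v = H u v + H u' v)
    (hsmul : ∀ (c : ℂ) (u v : E), H (c • u) v = c * H u v)
    (hswap : ∀ u v : E, H v u = conj (H u v))
    (hpos : ∀ u : E, u ≠ 0 → 0 < (H u u).re)
    (hint : ∀ m m' : ι → ℤ, H (latticeVec Ψ m) (latticeVec Ψ m') ∈
      (φ.comp (algebraMap (𝓞 K) K)).range) :
    ∃! ω : E [⋀^Fin 2]→L[ℝ] ℝ, IsRiemannForm Ψ ω ∧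
      ∀ u v : E, ((φ (b 1 : K)).im : ℂ) * hermOf ω u v = H u v := by
  obtain ⟨ω, hω, hωH⟩ := exists_isRiemannForm_mul_hermOf_eq φ b hb hα Ψ H hadd hsmul hswap hpos hint
  refine ⟨ω, ⟨hω, hωH⟩, fun ω' hω' ↦ eq_of_hermOf_eq fun u v ↦ ?_⟩
  have hα0 : ((φ (b 1 : K)).im : ℂ) ≠ 0 := Complex.ofReal_ne_zero.mpr hα.ne'
  exact mul_left_cancel₀ hα0 ((hω'.2 u v).trans (hωH u v).symm)

end Torus

/-! ## §4. The dual lattice: `Γ̂ = {ℓ ∈ V^*, Im ℓ(Γ) ⊆ ℤ} = {ℓ ∈ V^*, α_R ℓ(Γ) ⊆ R}` -/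

section DualLattice

variable {K : Type} [Field K] (φ : K →+* ℂ)
variable {ι : Type*} [Fintype ι] [DecidableEq ι] {E : Type*} [NormedAddCommGroup E]
  [NormedSpace ℂ E]

/-- **The dual lattice in hermitian terms: "`Γ̂ = {ℓ ∈ (ℂ^g)^*, Im ℓ(Γ) ⊆ ℤ} = {ℓ ∈ (ℂ^g)^*,
α_R ℓ(Γ) ⊆ R}`"** (Narbonne §1.2 / §3.3.1, "with Lemma 1"): for a torus `X = E/Ψ(ℤ^ι)` with `R`-stable
lattice `Γ`, an antilinear functional `ξ ∈ V^* = Ω̄` lies in the lattice `Λ̂` of the dual torus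
`X̂ = Ω̄/Λ̂` (the tree's `dualPeriod Ψ`, `Λ̂ = {ξ | Im ξ(Γ) ⊆ ℤ}`) iff `α · ξ(γ) ∈ R` for all `γ ∈ Γ` —
Lemma 1 for the `R`-module `α·ξ(Γ)` (`R`-stable because `ξ` is antilinear and `R̄ = R`).
[cite: Narbonne2022PolarizedProductsCM, §1.2 and §3.3.1 (display before Prop. 6), with §2.3 Lemma 1] -/
theorem exists_dualPeriod_intVec_eq_iff_forall_mem_range (b : Basis (Fin 2) ℤ (𝓞 K)) (hb : b 0 = 1)
    (hφ : (φ (b 1 : K)).im ≠ 0) (Ψ : (ι → ℝ) ≃L[ℝ] E)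
    (hΛ : ∀ (a : 𝓞 K) (m : ι → ℤ), ∃ m' : ι → ℤ, (φ (a : K)) • latticeVec Ψ m = latticeVec Ψ m')
    (ξ : E →L⋆[ℂ] ℂ) :
    (∃ m : ι → ℤ, dualPeriod Ψ (intVec m) = ξ) ↔
      ∀ n : ι → ℤ, ((φ (b 1 : K)).im : ℂ) * ξ (latticeVec Ψ n) ∈
        (φ.comp (algebraMap (𝓞 K) K)).range := by
  rw [mem_range_dualPeriod_intVec_iff]
  constructor
  · intro h
    set S : Set ℂ := {z | ∃ n : ι → ℤ, z = ((φ (b 1 : K)).im : ℂ) * ξ (latticeVec Ψ n)} with hSdef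
    -- `α·ξ(Γ)` is an `R`-module: `φ(r)·ξ(γ) = ξ(conj φ(r)·γ)` and `conj φ(r) ∈ R`
    have hS : ∀ (r : 𝓞 K), ∀ s ∈ S, φ (r : K) * s ∈ S := by
      rintro r s ⟨n, rfl⟩
      obtain ⟨r', hr'⟩ := conj_mem_range φ b hb hφ (z := φ (r : K)) ⟨r, rfl⟩
      obtain ⟨n', hn'⟩ := hΛ r' n
      refine ⟨n', ?_⟩
      have hc : conj (φ (r' : K)) = φ (r : K) := by
        rw [RingHom.comp_apply] at hr'
        change φ (r' : K) = _ at hr'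
        rw [hr', Complex.conj_conj]
      rw [← hn', ξ.map_smulₛₗ, starRingEnd_apply, RCLike.star_def, hc, smul_eq_mul]
      ring
    have him : ∀ s ∈ S, ∃ q : ℤ, s.im = q * (φ (b 1 : K)).im := by
      rintro s ⟨n, rfl⟩
      obtain ⟨k, hk⟩ := h n
      refine ⟨k, ?_⟩
      rw [Complex.im_ofReal_mul]
      change (φ (b 1 : K)).im * (ξ (Ψ (intVec n))).im = _
      rw [hk, mul_comm]
    exact fun n ↦ (subset_range_iff_forall_im φ b hb hφ hS).mpr him ⟨n, rfl⟩
  · intro h n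
    obtain ⟨q, hq⟩ := exists_int_im_eq_of_mem_range φ b hb (h n)
    rw [Complex.im_ofReal_mul] at hq
    exact ⟨q, mul_left_cancel₀ hφ (hq.trans (mul_comm _ _))⟩

end DualLattice

end ComplexTorus

end Literature.Geometry.Kaehler

end
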